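import Summits.Ventures.QEC.Census.CertInfoSetOrbitStabFast
import Summits.Ventures.QEC.Census.CertCheckParityFast
import Summits.Ventures.QEC.Census.CertBZPlaneSound
import Summits.Ventures.QEC.Census.TwoBGA.TB_g2_6_12_A0_0_0_0_0_5_1_0_1_B0_0_0_0_1_0_0_2_3.Cert
import HarnessLib

/-!
# `TB_g2_6_12_A0_0_0_0_0_5_1_0_1_B0_0_0_0_1_0_0_2_3` — checks module `ChecksV` (est 65 s) of the KERNEL-std certificate of census row `2bga-g2.6.12-A0-0-0.0-0-5.1-0-1-B0-0-0.0-1-0.0-2-3` (qec-search-4 g6 orbit-stabilized lane)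

the STABILIZED views: RREF certificates (`infoSetStructOK`) and the fast structural checks `StabView.stabOKF` (`F ⊇ free`, base points, mask/orbit-mask invariance of the movers); assembled in `Census/TwoBGA/TB_g2_6_12_A0_0_0_0_0_5_1_0_1_B0_0_0_0_1_0_0_2_3/Distance.lean`.  Generated by `emit_stab_row.py`; do not edit by hand.
-/

set_option autoImplicit false
set_option Elab.async false

namespace Summit.Ventures.QEC.Census.TB_g2_6_12_A0_0_0_0_0_5_1_0_1_B0_0_0_0_1_0_0_2_3

open Matrix Literature.InformationTheory.QuantumCodes Summit.Ventures.QEC.Census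

/-- Stabilized view 0 of the `X` side is an RREF certificate of `H^Z`. -/
theorem viewX_0_ok : infoSetStructOK TB_g2_6_12_A0_0_0_0_0_5_1_0_1_B0_0_0_0_1_0_0_2_3.cert.n TB_g2_6_12_A0_0_0_0_0_5_1_0_1_B0_0_0_0_1_0_0_2_3.cert.HZ TB_g2_6_12_A0_0_0_0_0_5_1_0_1_B0_0_0_0_1_0_0_2_3.svX0.ic = true := by decide +kernel

/-- Stabilized view 0 of the `X` side passes the FAST structural check `stabOKF` (`F ⊇ free`; base points, `F`- and orbit-mask invariance of the movers). -/
theorem stabX_0_ok : TB_g2_6_12_A0_0_0_0_0_5_1_0_1_B0_0_0_0_1_0_0_2_3.svX0.stabOKF TB_g2_6_12_A0_0_0_0_0_5_1_0_1_B0_0_0_0_1_0_0_2_3.cert.n (autPerms TB_g2_6_12_A0_0_0_0_0_5_1_0_1_B0_0_0_0_1_0_0_2_3.gensX) TB_g2_6_12_A0_0_0_0_0_5_1_0_1_B0_0_0_0_1_0_0_2_3.gensX.length = true := by decide +kernel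

/-- Stabilized view 0 of the `Z` side is an RREF certificate of `H^X`. -/
theorem viewZ_0_ok : infoSetStructOK TB_g2_6_12_A0_0_0_0_0_5_1_0_1_B0_0_0_0_1_0_0_2_3.cert.n TB_g2_6_12_A0_0_0_0_0_5_1_0_1_B0_0_0_0_1_0_0_2_3.cert.HX TB_g2_6_12_A0_0_0_0_0_5_1_0_1_B0_0_0_0_1_0_0_2_3.svZ0.ic = true := by decide +kernel

/-- Stabilized view 0 of the `Z` side passes the FAST structural check `stabOKF` (`F ⊇ free`; base points, `F`- and orbit-mask invariance of the movers). -/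
theorem stabZ_0_ok : TB_g2_6_12_A0_0_0_0_0_5_1_0_1_B0_0_0_0_1_0_0_2_3.svZ0.stabOKF TB_g2_6_12_A0_0_0_0_0_5_1_0_1_B0_0_0_0_1_0_0_2_3.cert.n (autPerms TB_g2_6_12_A0_0_0_0_0_5_1_0_1_B0_0_0_0_1_0_0_2_3.gensZ) TB_g2_6_12_A0_0_0_0_0_5_1_0_1_B0_0_0_0_1_0_0_2_3.gensZ.length = true := by decide +kernel

end Summit.Ventures.QEC.Census.TB_g2_6_12_A0_0_0_0_0_5_1_0_1_B0_0_0_0_1_0_0_2_3
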